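import Summits.Schanuel.Schanuel.Theorems.RootDecomp1BExplicitPair03

/-!
# RootDecomp1BExplicitPair — lens 4, generation 44 «EXPLICIT JU PAIR (ρ_J, σ_J) BY A MEASURE-FREE INDEPENDENCE CRITERION» (CLAIM L2220, ACK/CHECKLIST B-g44 L2225, NODE L2248 / REQUEST L2249, writer re-check L2254, critic VERDICT L2251: CLEARED — THEOREM ×1 «measure-free nested-approximation independence criterion + first explicit JU member»; RULE B-R30; lens-4 tally THEOREM ×8 + CELL ×4) — continuation (RootDecomp1BExplicitPair04): §4 storey-two cells by name + §5 controls

(lens-4 g44 HOME kernel K = HOME/decomp-schanuel-lens-4/g44/ExplicitPair.lean c215aab4…, 1070 l, import tree `…RootDecomp1BFactDischarge01` ONLY; P ExplicitPairProbe.lean 61d4e775… rc 0, C ExplicitPairCtrl.lean ef32d495… rc 1 = exactly the 12 planted errors. Port by census-1 gen 19 as `RootDecomp1BExplicitPair01`–`04` (after TwoStorey01–04, as sequenced): 01 = K doc + §1 the ONE new estimate «lower bound near a rational» (`shiftCoeff`, `qpow_mul_aeval_eq`, `exists_shiftCoeff_ne_zero`, `abs_shiftCoeff_le`, `lowest_term_dominates`,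 `eval_lower_near_rat`); 02 = §2 THE CRITERION (`NestedLiouville`, `algebraicIndependent_of_nestedLiouville`, sequence form `algebraicIndependent_of_dominated_approx`, the checklist's weighted shape `…_weighted`); 03 = §3 THE EXPLICIT PAIR (`rhoJ`/`sigmaJ` = even/odd sub-series of the tree tower `uTow`, `rhoJ_add_sigmaJ : rhoJ + sigmaJ = rhoU`, `nestedLiouville_rhoJ_sigmaJ`, `algebraicIndependent_rhoJ_sigmaJ`, `dominated_approx_rhoJ_sigmaJ`, `jointlyUltra_rhoJ_sigmaJ`, `JU_rhoJ_sigmaJ : JU rhoJ sigmaJ` against the TREE class, `exists_JU_explicit`); 04 = §4 each coordinate ultra-Liouville (tree `UltraLiouville`) ⟹ storey-two cells at `(1, ρ_J)`, `(1, σ_J)` BY NAME + §5 controls proved (`not_nestedLiouville_self`, `not_nestedLiouville_sq`, `frozen_level_insufficient`).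
PORT EDITS: `import …RootDecomp1BTwoStorey04` added and K's LOCAL COPIES of `UltraLiouville₂`, `JU` (§3.6) and of g43's `not_algebraicIndependent_sq` DELETED — the tree decls of `RootDecomp1BTwoStorey02/04` are used BY NAME (verdict condition); the file-wide linter option dropped; 23 one-line docstrings added to §3 helper lemmas; 8 generic helpers made PRIVATE (dedup-safety: `aeval_ofReal_int` has name-and-statement twins in RadixCell04 / AlgFrame01; `sum_abs_coeff_eq_len`, `mul_pow_le_of_lt_inv_pow`, `lt_two_pow_of_le_nat`, `half_pow_mul_two_lt`, `threshold_mono`, `den_eq_of_odd`, `not_algebraicIndependent_self`) with per-part private copies; `variable {ρ σ : ℝ}` (implicit binders only) kept; graded statements and proofs verbatim. `--supports stmt-Schanuel-24622`; no census credit carried; rung 0 — nothing here proves Schanuel; `KleinPolarSchanuel`, t(1,ρ_J) ≥ 5 NOT derived.)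
-/

noncomputable section

open Complex Filter Polynomial Finset

namespace Summit.Schanuel.Schanuel.Theorems.RootDecomp1BExplicitPair

open Summit.Schanuel.Schanuel.Theorems.RootDecomp1BTwoStorey (UltraLiouville₂ JU not_algebraicIndependent_sq)

open Summit.Schanuel.Schanuel.Theorems.RootDecomp1KHyper (len len_nonneg len_le_of_natDegree_le one_le_len
  abs_coeff_le_len exists_int_relation exists_ball_eval_ne_zero exists_lipschitz_at_root specialise
  aeval_specialise natDegree_specialise_le len_specialise_le transcendental_ofReal_of_liouville)

/-! ## §4  EACH COORDINATE IS ULTRA-LIOUVILLE (tree `UltraLiouville`, reduced denominators) ⟹ the storey-two cells at `(1, ρ_J)`, `(1, σ_J)` BY NAME -/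

section Cells
open Summit.Schanuel.Schanuel.Theorems.RootDecomp1BRadicalDescent (uTow uTow_strictMono le_uTow uTerm
  tail_lt_threshold UltraLiouville)
open Summit.Schanuel.Schanuel.Theorems.RootDecomp1BFedFlagCore (polarDeg)

/-- at an EVEN level the numerator `A_K` is odd (its last term is `2^0`, the others are even) -/
theorem eNum_odd_of_even {K : ℕ} (hK : Even K) : Odd (eNum K) := by
  unfold eNum
  rw [Finset.sum_range_succ, if_pos hK, Nat.sub_self, pow_zero]
  have hdvd : 2 ∣ ∑ j ∈ range K, (if Even j then 2 ^ (uTow K - uTow j) else 0) := by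
    refine Finset.dvd_sum fun j hj => ?_
    split_ifs
    · have hlt : uTow j < uTow K := uTow_strictMono (mem_range.mp hj)
      rw [show uTow K - uTow j = (uTow K - uTow j - 1) + 1 by omega, pow_succ]
      exact dvd_mul_left 2 _
    · exact dvd_zero 2
  obtain ⟨c, hc⟩ := hdvd
  exact ⟨c, by rw [hc]⟩

/-- at an ODD level the numerator `B_K` is odd -/
theorem oNum_odd_of_not_even {K : ℕ} (hK : ¬ Even K) : Odd (oNum K) := by
  unfold oNum
  rw [Finset.sum_range_succ, if_neg hK, Nat.sub_self, pow_zero]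
  have hdvd : 2 ∣ ∑ j ∈ range K, (if Even j then 0 else 2 ^ (uTow K - uTow j)) := by
    refine Finset.dvd_sum fun j hj => ?_
    split_ifs
    · exact dvd_zero 2
    · have hlt : uTow j < uTow K := uTow_strictMono (mem_range.mp hj)
      rw [show uTow K - uTow j = (uTow K - uTow j - 1) + 1 by omega, pow_succ]
      exact dvd_mul_left 2 _
  obtain ⟨c, hc⟩ := hdvd
  exact ⟨c, by rw [hc]⟩

/-- the `K`-th partial sum of `ρ_J` as a rational -/
def eRat (K : ℕ) : ℚ := (eNum K : ℚ) / 2 ^ uTow K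

/-- the `K`-th partial sum of `σ_J` as a rational -/
def oRat (K : ℕ) : ℚ := (oNum K : ℚ) / 2 ^ uTow K

/-- `eRat K` as a real number. -/
theorem eRat_cast (K : ℕ) : ((eRat K : ℚ) : ℝ) = (eNum K : ℝ) / 2 ^ uTow K := by
  unfold eRat; push_cast; rfl

/-- `oRat K` as a real number. -/
theorem oRat_cast (K : ℕ) : ((oRat K : ℚ) : ℝ) = (oNum K : ℝ) / 2 ^ uTow K := by
  unfold oRat; push_cast; rfl

/-- reduced denominator of an odd-over-power-of-two fraction -/
private theorem den_eq_of_odd {N e : ℕ} (hN : Odd N) : ((N : ℚ) / 2 ^ e).den = 2 ^ e := by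
  have hcop : Nat.Coprime N (2 ^ e) := Nat.Coprime.pow_right _ hN.coprime_two_right
  have h := Rat.den_div_eq_of_coprime (a := (N : ℤ)) (b := ((2 ^ e : ℕ) : ℤ)) (by positivity)
    (by simpa using hcop)
  have hq : ((N : ℤ) : ℚ) / (((2 ^ e : ℕ) : ℤ) : ℚ) = (N : ℚ) / 2 ^ e := by push_cast; rfl
  rw [hq] at h
  exact_mod_cast h

/-- At even `K` the reduced denominator of `eRat K` is `2^{u_K}`. -/
theorem eRat_den {K : ℕ} (hK : Even K) : (eRat K).den = 2 ^ uTow K := den_eq_of_odd (eNum_odd_of_even hK)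

/-- At odd `K` the reduced denominator of `oRat K` is `2^{u_K}`. -/
theorem oRat_den {K : ℕ} (hK : ¬ Even K) : (oRat K).den = 2 ^ uTow K :=
  den_eq_of_odd (oNum_odd_of_not_even hK)

/-- monotonicity of the ultra-Liouville threshold in the order -/
private theorem threshold_mono {q : ℕ} (hq : 1 ≤ q) {m K : ℕ} (h : m ≤ K) :
    Real.exp (-Real.exp (((q : ℕ) : ℝ) ^ K)) ≤ Real.exp (-Real.exp (((q : ℕ) : ℝ) ^ m)) := by
  apply Real.exp_le_exp.mpr
  apply neg_le_neg
  apply Real.exp_le_exp.mpr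
  exact pow_le_pow_right₀ (by exact_mod_cast hq) h

/-- **`ρ_J` IS ULTRA-LIOUVILLE** (tree `UltraLiouville`, reduced denominators `2^{u_{2m}}`; hypothesis-free). -/
theorem ultraLiouville_rhoJ : UltraLiouville rhoJ := by
  intro m
  have hKe : Even (2 * m) := even_two_mul m
  refine ⟨eRat (2 * m), ?_, ?_, ?_⟩
  · rw [eRat_den hKe]
    exact (show m ≤ 2 * m by omega).trans ((le_uTow _).trans Nat.lt_two_pow_self.le)
  · intro h
    have := eTail_pos (2 * m)
    rw [← rhoJ_sub, ← eRat_cast, ← h, sub_self] at this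
    exact lt_irrefl _ this
  · rw [eRat_cast, rhoJ_sub, abs_of_pos (eTail_pos _), eRat_den hKe]
    exact (eTail_le _).trans_lt ((tail_lt_threshold (2 * m)).trans_le
      (threshold_mono Nat.one_le_two_pow (by omega)))

/-- **`σ_J` IS ULTRA-LIOUVILLE** (reduced denominators `2^{u_{2m+1}}`; hypothesis-free). -/
theorem ultraLiouville_sigmaJ : UltraLiouville sigmaJ := by
  intro m
  have hKo : ¬ Even (2 * m + 1) := Nat.not_even_iff_odd.mpr (odd_two_mul_add_one m)
  refine ⟨oRat (2 * m + 1), ?_, ?_, ?_⟩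
  · rw [oRat_den hKo]
    exact (show m ≤ 2 * m + 1 by omega).trans ((le_uTow _).trans Nat.lt_two_pow_self.le)
  · intro h
    have := oTail_pos (2 * m + 1)
    rw [← sigmaJ_sub, ← oRat_cast, ← h, sub_self] at this
    exact lt_irrefl _ this
  · rw [oRat_cast, sigmaJ_sub, abs_of_pos (oTail_pos _), oRat_den hKo]
    exact (oTail_le _).trans_lt ((tail_lt_threshold (2 * m + 1)).trans_le
      (threshold_mono Nat.one_le_two_pow (by omega)))

/-- **X(2)(1, ρ_J): `t(1, ρ_J) ≥ 4`** — the storey-two cell at the first new member, BY NAME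
(`RootDecomp1BFactDischarge.four_le_polarDeg_one_ultra`; hypothesis-free). -/
theorem four_le_polarDeg_one_rhoJ : ((2 + 2 : ℕ) : Cardinal) ≤ polarDeg ![(1 : ℝ), rhoJ] :=
  RootDecomp1BFactDischarge.four_le_polarDeg_one_ultra ultraLiouville_rhoJ

/-- **X(2)(1, σ_J): `t(1, σ_J) ≥ 4`** — BY NAME (hypothesis-free). -/
theorem four_le_polarDeg_one_sigmaJ : ((2 + 2 : ℕ) : Cardinal) ≤ polarDeg ![(1 : ℝ), sigmaJ] :=
  RootDecomp1BFactDischarge.four_le_polarDeg_one_ultra ultraLiouville_sigmaJ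

/-- `(ρ_J, σ_J)` read against the lens-4 g31 named member: `ρ_U = ρ_J + σ_J` splits into two algebraically
independent ultra-Liouville halves. -/
theorem rhoU_eq_rhoJ_add_sigmaJ :
    Summit.Schanuel.Schanuel.Theorems.RootDecomp1BRadicalDescent.rhoU = rhoJ + sigmaJ :=
  rhoJ_add_sigmaJ.symm

end Cells

/-! ## §5  CONTROLS, PROVED (each binder of the criterion is load-bearing; the planted type-level controls are in
the control file) -/

section Controls

/-- CONTROL: the diagonal pair `(x, x)` is never algebraically independent (relation `X₀ − X₁`). -/
private theorem not_algebraicIndependent_self (x : ℂ) : ¬ AlgebraicIndependent ℚ ![x, x] := by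
  intro h
  have h0 : MvPolynomial.aeval ![x, x] (MvPolynomial.X 0 - MvPolynomial.X 1 : MvPolynomial (Fin 2) ℚ) = 0 := by
    simp
  have h1 := algebraicIndependent_iff.1 h _ h0
  have h2 := congrArg (MvPolynomial.aeval ![(1 : ℚ), 0]) h1
  simp at h2

/-- … so the criterion REFUSES `σ := ρ`: `NestedLiouville ρ ρ` is FALSE for every real `ρ` (on the diagonal the
domination binder `|σ − b/q| < |ρ − a/q|^k` cannot hold at every level). -/
theorem not_nestedLiouville_self (ρ : ℝ) : ¬ NestedLiouville ρ ρ :=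
  fun h => not_algebraicIndependent_self (ρ : ℂ) (algebraicIndependent_of_nestedLiouville h)

/-- … so the criterion REFUSES `σ := ρ²`: `NestedLiouville ρ (ρ²)` is FALSE for every real `ρ`. -/
theorem not_nestedLiouville_sq (ρ : ℝ) : ¬ NestedLiouville ρ (ρ ^ 2) :=
  fun h => not_algebraicIndependent_sq ρ (algebraicIndependent_of_nestedLiouville h)

/-- CONTROL (a genuine counterexample): ONE level of nesting — of arbitrarily high order `k` — does NOT give
algebraic independence: the RATIONAL pair `ρ = 2^{-(k+2)}`, `σ = 2^{-(k+1)^2}` with `q = 2`, `a = b = 0` satisfies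
the level-`k` body of `NestedLiouville` (`0 < ρ < 2^{-k}`, `0 < σ < ρ^k = 2^{-k(k+2)}`) and is algebraically
dependent.  The binder `∀ k` (infinitely many levels) is load-bearing. -/
theorem frozen_level_insufficient (k : ℕ) : ∃ ρ σ : ℝ,
    (∃ (q : ℕ) (a b : ℤ), 2 ≤ q ∧ ρ ≠ a / q ∧ σ ≠ b / q ∧ |ρ - a / q| < 1 / (q : ℝ) ^ k ∧
      |σ - b / q| < |ρ - a / q| ^ k) ∧ ¬ AlgebraicIndependent ℚ ![(ρ : ℂ), (σ : ℂ)] := by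
  have hkk : (k + 2) * k < (k + 1) * (k + 1) := by nlinarith
  refine ⟨((1 : ℝ) / 2) ^ (k + 2), ((1 : ℝ) / 2) ^ ((k + 1) * (k + 1)), ⟨2, 0, 0, le_rfl, ?_, ?_, ?_, ?_⟩, ?_⟩
  · simp
  · simp
  · rw [Int.cast_zero, zero_div, sub_zero, abs_of_pos (by positivity), Nat.cast_ofNat, ← one_div_pow]
    exact pow_lt_pow_right_of_lt_one₀ (by norm_num) (by norm_num) (by omega)
  · rw [Int.cast_zero, zero_div, sub_zero, sub_zero, abs_of_pos (by positivity), abs_of_pos (by positivity),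
      ← pow_mul]
    exact pow_lt_pow_right_of_lt_one₀ (by norm_num) (by norm_num) hkk
  · intro h
    have h0 : MvPolynomial.aeval ![((((1 : ℝ) / 2) ^ (k + 2) : ℝ) : ℂ), ((((1 : ℝ) / 2) ^ ((k + 1) * (k + 1)) : ℝ) : ℂ)]
        (MvPolynomial.X 0 - MvPolynomial.C (((1 : ℚ) / 2) ^ (k + 2)) : MvPolynomial (Fin 2) ℚ) = 0 := by
      simp
    have h1 := algebraicIndependent_iff.1 h _ h0
    have h2 := congrArg (MvPolynomial.aeval ![(0 : ℚ), 0]) h1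
    simp at h2

end Controls

end Summit.Schanuel.Schanuel.Theorems.RootDecomp1BExplicitPair

end
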